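import Summits.QuantumFields.BalabanUV.Beta.GAN24.DressedStepFaceCharges
import Summits.QuantumFields.BalabanUV.Beta.GAN24.MultiplierVertexBondSum

/-!
# `BalabanUV.Beta.GAN24.DressedMultiplierVertexZero` — binder row G-an2-4 ∕ (CONV-C), W-slot CT-W, conservation law (C)∕(C)sym, step (E1) (the M1 words) of this lineage's
# note `HOME/b2b-balaban-gan24-formalise-leaf-04/g65/CSYM-LEVEL0-KERNEL-BLUEPRINT.md` §4: **THE MULTIPLIER-SECTOR HALF-VERTEX `vertexOfM` THROUGH THE DRESSED STEP KERNEL,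
# RESUMMED OVER ITS BACKGROUND BOND, VANISHES** — the mm block of `Πkᵀ∘K∘Πk` is the mm block of `K` (both dressings are the identity on multiplier legs), so the (S2c)
# column charge zero of `KInvStep Lc j` (leaf-14's `MultiplierZeroMass`) passes to `unitK s_f s_m (coDressKBmAt ρ Lc (KInvStep Lc j))`, and leaf-14∕leaf-06's
# `MultiplierVertexBondSum.hasSum_vertexOfM_bond` applies verbatim

NOT IN PRINT; OUR BOOKKEEPING ([folklore] BY NAME over an2's `AxialDressingRooted.coDressKBmAt ∕ comp_piKBm_inr`, the sibling `DressedStepFaceCharges.comp_trK_piKBm_inr`, leaf-14's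
`MultiplierZeroMass.hasSum_KInvStep_mm_right`, leaf-06∕14's `MultiplierVertexBondSum.hasSum_vertexOfM_bond`, an4's `decays_KInvStep`, an2's `decays_coDressKBmAt`, `decays_unitK`;
G-an2-4 formalisation swarm, leaf prover `b2b-balaban-gan24-formalise-leaf-04`, gen 65).  HONEST FRAMING (cell contract, verbatim): «discharging `BetaPertH` makes Bałaban's UV
stability UNCONDITIONAL — a real constructive-QFT result; it is NOT the continuum limit and NOT the Clay problem.»  HONEST DEPENDENCY (verbatim): «continuum YM on T⁴ ⇐
BetaPertH ∧ nine spine estimates (0/9 proved); BetaPertH ⇐ (D1) ∧ (D4) ∧ CAP+tail; G-an2-4 gates asym, D1 and NE2/3/4.»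

WHY (blueprint §4 (E1), note g64 §3 (a)): `dM = vertexOfK X S + vertexOfM X M`; in the exchange words of the dressed one-step source every word containing a `vertexOfM`
half-vertex whose background bond is summed over the lattice vanishes — the dead M1 ∕ MIX sectors of the level-0 anatomy («`c = colM(X)·1 = 0`: (S2c) and `G_mm = K_mm`»),
now for the DRESSED kernel by name.

WHAT ([folklore]; 0 `def`, 0 cited facts, 0 `def … : Prop`, 0 sorry): `coDressKBmAt_inr_inr` (the mm block is undressed), `unitK_coDressKBmAt_inr_inr`, **`hasSum_colM_dressedStep`**
(`HasSum (y ↦ colM X̃♮_j Lc μ y ρ w) 0`, in-block root not even needed), **`hasSum_vertexOfM_dressedStep`** (in-block root, `1 ≤ Lc`, every `j`, all units, every vertex family `M`: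
`HasSum (u′ ↦ vertexOfM X̃♮_j Lc M ν u′ x z a b) 0`).  Asserts NO value of Bałaban's tables; discharges NOTHING of (C)sym ∕ (Q-D) ∕ (Q-D-rate) ∕ «T2Shape» ∕ «T2Drift» ∕ (hW, hWall);
NEVER «G-an2-4 closed» as (CONV-C); NOT D1, NOT `BetaPertH`, NOT continuum, NOT Clay.  2026-08-22; no existing file touched.
-/

noncomputable section

open Finset
open scoped BigOperators
open Literature.MathematicalPhysics.QuantumFieldTheory
open Literature.MathematicalPhysics.QuantumFieldTheory.Balaban1983to89
open Literature.MathematicalPhysics.QuantumFieldTheory.Balaban1983to89.Beta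
open ExpKernelCalculus (Site MKer Decays VertexFamily)
open OneStepResolventKernel (Fib decays_mono)
open OneStepKernelFamily (KInvStep decays_KInvStep)
open SecondOrderResponse (colM vertexOfM)
open AffineAveraging (box toSite)
open Summit.QuantumFields.BalabanUV.Beta.TameKernelCalculus (trK)
open Summit.QuantumFields.BalabanUV.Beta.AxialDressingRooted (piKBm coDressKBmAt coDressKBmAt_eq comp_piKBm_inr decays_coDressKBmAt)
open Summit.QuantumFields.BalabanUV.Beta.HessKerDressedUnits (unitK unitK_apply legScale_inr decays_unitK)
open Summit.QuantumFields.BalabanUV.Beta.GAN24.DressedStepFaceCharges (comp_trK_piKBm_inr)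
open Summit.QuantumFields.BalabanUV.Beta.GAN24.MultiplierZeroMass (hasSum_KInvStep_mm_right)
open Summit.QuantumFields.BalabanUV.Beta.GAN24.MultiplierVertexBondSum (hasSum_vertexOfM_bond)

namespace Summit.QuantumFields.BalabanUV.Beta.GAN24.DressedMultiplierVertexZero

variable {d : ℕ} {N : ℕ}

/-- [folklore] **THE MULTIPLIER–MULTIPLIER BLOCK OF A CO-DRESSED KERNEL IS UNDRESSED**: `(Πkᵀ∘K∘Πk) x y (inr m) (inr m′) = K x y (inr m) (inr m′)`. -/
theorem coDressKBmAt_inr_inr (ρ : Fin (d + 1) → ℤ) (K : MKer (d + 1) (Fib d)) (x y : Site (d + 1)) (m m' : Fin (d + 1)) :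
    coDressKBmAt ρ N K x y (Sum.inr m) (Sum.inr m') = K x y (Sum.inr m) (Sum.inr m') := by
  rw [coDressKBmAt_eq, comp_piKBm_inr, comp_trK_piKBm_inr]

/-- [folklore] … and through the units: `unitK s_f s_m (Πkᵀ∘K∘Πk) x y (inr m) (inr m′) = s_m²·K x y (inr m) (inr m′)`. -/
theorem unitK_coDressKBmAt_inr_inr (ρ : Fin (d + 1) → ℤ) (sf sm : ℝ) (K : MKer (d + 1) (Fib d)) (x y : Site (d + 1)) (m m' : Fin (d + 1)) :
    unitK sf sm (coDressKBmAt ρ N K) x y (Sum.inr m) (Sum.inr m') = sm * sm * K x y (Sum.inr m) (Sum.inr m') := by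
  rw [unitK_apply, legScale_inr, legScale_inr, coDressKBmAt_inr_inr]
  ring

variable {Lc : ℕ} [NeZero Lc] {r : Fin (d + 1) → ℕ}

/-- [folklore] **THE mm COLUMN CHARGE OF THE DRESSED STEP KERNEL VANISHES** ((S2c) BY NAME: leaf-14's `MultiplierZeroMass.hasSum_KInvStep_mm_right`): for
`X̃♮_j = unitK s_f s_m (coDressKBmAt ρ Lc (KInvStep Lc j))`, `HasSum (y ↦ colM X̃♮_j Lc μ y ρ′ w) 0` — any root `ρ`. -/
theorem hasSum_colM_dressedStep (ρ : Fin (d + 1) → ℤ) (sf sm : ℝ) (j : ℕ) (μ ρ' : Fin (d + 1)) (w : Site (d + 1)) :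
    HasSum (fun y : Site (d + 1) => colM (unitK sf sm (coDressKBmAt ρ Lc (KInvStep (d := d) Lc j))) Lc μ y ρ' w) 0 := by
  have h := (hasSum_KInvStep_mm_right (d := d) (Lc := Lc) j ρ' μ (((Lc : ℕ) : ℤ) • w)).mul_left (sm * sm)
  rw [mul_zero] at h
  refine h.congr_fun fun y => ?_
  simp only [colM, unitK_coDressKBmAt_inr_inr]

/-- [folklore] **THE MULTIPLIER-SECTOR HALF-VERTEX THROUGH THE DRESSED STEP KERNEL, RESUMMED OVER ITS BACKGROUND BOND, VANISHES** (in-block root `ρ = toSite r`, `1 ≤ Lc`,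
every `j`, all units, every vertex family `M` at a positive rate): `HasSum (u′ ↦ vertexOfM X̃♮_j Lc M ν u′ x z a b) 0` — leaf-06∕14's `MultiplierVertexBondSum.hasSum_vertexOfM_bond`
with the dressed kernel's decay (`decays_coDressKBmAt` + `decays_unitK`) and `hasSum_colM_dressedStep`.  The M1 words of the dressed source with this slot summed over the
lattice are therefore zero, exactly as for the undressed kernel. -/
theorem hasSum_vertexOfM_dressedStep (hLc : 1 ≤ Lc) (hr : r ∈ box (d + 1) Lc) (sf sm : ℝ) (j : ℕ)
    {M : Fin (d + 1) → Site (d + 1) → MKer (d + 1) (Fib d)} {CM δM : ℝ} (hM : VertexFamily M Lc CM δM) (hδM : 0 < δM)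
    (ν : Fin (d + 1)) (x z : Site (d + 1)) (a b : Fib d) :
    HasSum (fun u' : Site (d + 1) => vertexOfM (unitK sf sm (coDressKBmAt (toSite r) Lc (KInvStep (d := d) Lc j))) Lc M ν u' x z a b) 0 := by
  obtain ⟨δ, C', hδ, -, hK'⟩ := decays_coDressKBmAt hLc hr (decays_KInvStep (d := d) (Lc := Lc) j)
  have hKu : Decays (unitK sf sm (coDressKBmAt (toSite r) Lc (KInvStep (d := d) Lc j))) (max |sf| |sm| * C' * max |sf| |sm|) δ := decays_unitK hK'
  exact hasSum_vertexOfM_bond (N := Lc) hKu hδ (fun μ ρ' w => hasSum_colM_dressedStep (toSite r) sf sm j μ ρ' w) hM hδM ν x z a b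

end Summit.QuantumFields.BalabanUV.Beta.GAN24.DressedMultiplierVertexZero

end
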